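import Literature.NumberTheory.Automorphic.LevelActionReductionKernel
import Literature.Algebra.Homology.GroupCohomologySemilinearSurjective
import HarnessLib

/-!
# `H^i(U, V) → H^i(U, V/ϖV)` is surjective when `H^{i+1}(U, V) = 0` (coefficients-at-`p` model)

Topic `NumberTheory/Automorphic`; namespaces `Literature.NumberTheory.Automorphic.LevelAction`
(generic) and `…ParallelWeight` (the `𝒪`-lattice `⨂_τ Sym^{k−2}(𝒪²)`); theorems only, the companion
of `LevelActionReductionKernel` at the other end of the universal-coefficient sequence
`0 → H^i(U, V)/ϖ → H^i(U, V/ϖ) → H^{i+1}(U, V)[ϖ] → 0` ([Hida1994AIF, §3]; [KhareThorne2017, §6.4]):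

* **`cohomologySemimap_surjective_of_subsingleton`** — for a surjective equivariant coefficient map
  `φ : V → V'` with `ker φ = ϖV`, `ϖ` injective on `V`, and `H^{i+1}(U, τ) = 0`, the map
  `H^i(φ) : H^i(U, τ) → H^i(U, τ')` is surjective (`GroupCohomologySemilinearSurjective`);
* **`reductionCohomology_surjective_of_subsingleton`** — for the lattice over a domain `𝒪`, `ϖ ≠ 0`:
  `reductionCohomology (ϖ) : H^i(U, ⨂_τ Sym(𝒪²)) → H^i(U, ⨂_τ Sym((𝒪/ϖ)²))` is surjective when
  `H^{i+1}(U, ⨂_τ Sym(𝒪²)) = 0` — in Hida's control theorem this is used in the top degree `i = 2`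
  of a neat Bianchi level. [cite: Hida1994AIF, §3] [cite: KhareThorne2017, §6.4]

## References

* H. Hida, Ann. Inst. Fourier 44 (1994), §3 (held). [Hida1994AIF]
* C. Khare, J. A. Thorne, Amer. J. Math. 139 (2017), §6.4 (arXiv:1409.7007, held). [KhareThorne2017]
* K. S. Brown, *Cohomology of Groups*, GTM 87 (1982), III.6 (held). [Brown1982CohomologyGroups]
-/

noncomputable section

open CategoryTheory Literature.Algebra.Homology IsDedekindDomain NumberField
open scoped Pointwise

namespace Literature.NumberTheory.Automorphic.LevelAction

universe u

section Generic

variable {R R' : Type u} [CommRing R] [CommRing R'] {σ : R →+* R'} {Γ 𝒢 : Type u} [Group Γ] [Group 𝒢]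
  (ι : Γ →* 𝒢) (Δ : Submonoid 𝒢) {V V' : Type u} [AddCommGroup V] [Module R V] [AddCommGroup V']
  [Module R' V'] (τ : Δ →* Module.End R V) (τ' : Δ →* Module.End R' V') (U : Subgroup 𝒢)
  (hU : U.toSubmonoid ≤ Δ) (φ : V →ₛₗ[σ] V') (hφ : ∀ (δ : Δ) (v : V), φ (τ δ v) = τ' δ (φ v))

/-- **`H^i(U, τ) → H^i(U, τ')` is surjective when `H^{i+1}(U, τ) = 0`**, for a surjective equivariant
coefficient map `φ` with `ker φ = ϖ V`, `ϖ` injective on `V`.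
[cite: Brown1982CohomologyGroups, III.6 Prop. 6.1] [cite: Hida1994AIF, §3] -/
theorem cohomologySemimap_surjective_of_subsingleton (ϖ : R) (htf : ∀ v : V, ϖ • v = 0 → v = 0)
    (hker : ∀ v : V, φ v = 0 ↔ ∃ v', ϖ • v' = v) (hsurj : Function.Surjective φ) (i : ℕ)
    [Subsingleton (cohomology ι Δ τ U (i + 1))] :
    Function.Surjective (cohomologySemimap ι Δ τ τ' U hU φ hφ i) :=
  semimap_smul_id_surjective_of_subsingleton (A := Rep.of (rep ι Δ τ U)) (B := Rep.of (rep ι Δ τ' U)) ϖ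
    (fun f hf => smul_sections_eq_zero Δ τ U ϖ htf f hf) (sectionsSemimap Δ τ τ' U hU φ hφ)
    (fun γ f => sectionsSemimap_rep ι Δ τ τ' U hU φ hφ γ f)
    (fun f => sectionsSemimap_eq_zero_iff Δ τ τ' U hU φ hφ ϖ htf hker f)
    (sectionsSemimap_surjective Δ τ τ' U hU φ hφ hsurj) i

end Generic

end Literature.NumberTheory.Automorphic.LevelAction

/-! ### The `𝒪`-lattice `⨂_τ Sym^{k−2}(𝒪²)` -/

namespace Literature.NumberTheory.Automorphic.ParallelWeight

open BigHeckeGLn IntegralWeightGL2 LevelAction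

variable (O : Type) [CommRing O] (E : Type) [Field E] [CharZero E] (F : Type) [Field F]
  [NumberField F] (k : ℕ) (v : (F →+* E) → HeightOneSpectrum (𝓞 F))
  (φO : ∀ τ : F →+* E, (v τ).adicCompletionIntegers F →+* O) (ϖ : O)

variable {Γ : Type} [Group Γ] (ι : Γ →* FiniteAdelicGL 2 F) {U : Subgroup (FiniteAdelicGL 2 F)}
  (hU : U.toSubmonoid ≤ integralMonoid F v) (i : ℕ)

/-- **`H^i(U, ⨂_τ Sym(𝒪²)) → H^i(U, ⨂_τ Sym((𝒪/ϖ)²))` is surjective when `H^{i+1}(U, ⨂_τ Sym(𝒪²)) = 0`**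
(`𝒪` a domain, `ϖ ≠ 0`). [cite: Hida1994AIF, §3] [cite: KhareThorne2017, §6.4] -/
theorem reductionCohomology_surjective_of_subsingleton [IsDomain O] (hϖ : ϖ ≠ 0)
    [Subsingleton (LevelAction.cohomology ι (integralMonoid F v) (symLatticeAction O E F k v φO) U (i + 1))] :
    Function.Surjective (reductionCohomology O E F k v φO (Ideal.span {ϖ}) ι hU i) :=
  cohomologySemimap_surjective_of_subsingleton ι (integralMonoid F v) _ _ U hU (latticeReduce O E F k (Ideal.span {ϖ}))
    (fun g x => latticeReduce_symLatticeAction O E F k v φO (Ideal.span {ϖ}) g x) ϖ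
    (fun x hx => smul_lattice_eq_zero O E F k ϖ hϖ x hx) (latticeReduce_eq_zero_iff O E F k ϖ)
    (latticeReduce_surjective O E F k _) i

end Literature.NumberTheory.Automorphic.ParallelWeight
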